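import Mathlib
import Literature.MathematicalPhysics.QuantumFieldTheory.Balaban1983to89.B6Ineq243BoxProof

/-!
# `Balaban1983to89.B6Prop22BoxLaplacian` — T. Bałaban, *Propagators and renormalization transformations for lattice
gauge theories. II*, Commun. Math. Phys. **96** (1984) 223–250 [Balaban1984PropagatorsII]: **(2.44), (2.50) and
Proposition 2.2 (2.67)₁ on the one-scale box, hypothesis-free, and the printed operator `Δ′_a = −Δ + a`** (−Δ = the
graph Laplacian of the nearest-neighbour graph of the box, Mathlib `SimpleGraph.lapMatrix`; (2.13) with Q′₀ = I)

statement-level skeleton of published theorems with citation tags; proofs where landed; nothing here is a claim about the Yang–Mills mass gap.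
PDF held: `paper:balaban1984-cmp96-propagators-rt-ii` (journal page = PDF page + 222); pp. 225, 229–235 [PDF 3, 7–13]
read this session (`lit read paper:balaban1984-cmp96-propagators-rt-ii --pages 7-16`, ×2 render `…-p013-x2.png`).

CITATION HEADER (cell `lit-balaban`, Phase-2 proof seat `p01` (gen 3) = unit `lit-balaban-p01`, HOME
`run/shared/lean/pub/lit-balaban/` (`PHASE2-TARGETS.md` §G, ruling G.5-34(d)); SKELETON rows **`B6.Eq2.44`**, **`B6.Eq2.49`**
((2.49)–(2.50)) and **`B6.Prop2.2`** (first entry of (2.67)) — kind «model-instance» on the printed one-level cover, now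
HYPOTHESIS-FREE for the printed operator; companion of this seat's `…B6Ineq243BoxProof` (IMPORTED, not modified: (2.43)₁
for the Dirichlet local inverses `localInverse_decay`, the local-inverse property `localInverse_identity`, the dictionary
`toLin_*`, `prop22_entry1_box`), which itself closes gens 1–2 (`…B6Ineq249Proof` p243144/p243405, `…B6Ineq266Proof`
p244416, `…B6Ineq244BoxProof` p244807/p247703).  Reused BY NAME: `B6Ineq244BoxProof.box_kernel244_of_243/
box_neumann250_of_243`, `B6Eq250.gZero/rOp/bTerm` (reader r03), `B6CoverBox.bdist/cubeInd/hprof/Kbox`, Mathlib's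
`SimpleGraph.lapMatrix/posSemidef_lapMatrix/isSymm_lapMatrix/adjMatrix_apply`.
WHAT THE PAPER PRINTS.  (2.13) p. 225 [PDF 3]: *"Δ′_a = Δ + Q′*aQ′, ⟨λ, Q′*aQ′λ⟩ = Σ_{j=0}^k Σ_{y∈Λ_j} a_j(L^jη)^{d−2}
|(Q′_jλ)(y)|² … (Q′₀λ)(x) = λ(x) on Λ₀"*; p. 230 [PDF 8]: *"This inequality [(2.43)] and (2.40) imply |(K(h_□)G′(□)h_□λ)(x)|
≤ O(M⁻¹)e^{−δ₀|x−y|}|λ| (2.44)"*; p. 232 [PDF 10]: *"G′ = G′₀(I − R)⁻¹ = Σ_{n=0}^∞ G′₀Rⁿ (2.50)"*; p. 234 [PDF 12],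
Proposition 2.2 (2.67), first entry: *"|(G′λ)(x)| ≤ O(1)(L^jη)²e^{−½δ₀d(y,y′)}|λ|"* for *"M sufficiently large"*; p. 235
[PDF 13]: *"If we have one scale, i.e. Λ_k = T₁^{(k)}, then the operator is a unit lattice operator."*
WHAT IS PROVED HERE (0 sorry, 0 new definitions, 0 named facts), on the box 𝔅 = {0,…,nM}^d of `B6CoverBox` (blocks =
sites, ℓ¹ distance), with the cut-offs h_k of (2.36) and the Dirichlet local inverses G′(□_k) = □_kP_k⁻¹□_k of
`…B6Ineq243BoxProof` §2:
§1 for EVERY symmetric, γ-coercive, nearest-neighbour Δ′_a with off-diagonal absolute row sums ≤ κ₀ and every δ₀ with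
  κ₀(e^{δ₀} − 1) < γ (A = (γ − κ₀(e^{δ₀} − 1))⁻¹): **`box_kernel244_dirichlet`** = (2.44) `|((h_kΔ′_a − Δ′_ah_k)G′(□_k)h_k)(x,y)|
  ≤ (3π/2)Aκ₀e^{δ₀}M⁻¹e^{−δ₀|x−y|₁}` (matrix form, O(M⁻¹) explicit); **`box_neumann250_dirichlet`** = (2.50): for
  `M > 2^dK(δ₀)(3π/2)Aκ₀e^{δ₀}` the series `Σ_N G′₀R^N` converges to Δ′_a⁻¹ in the operator norm of L^∞(𝔅) — gen 1/2's
  `box_kernel244_of_243` / `box_neumann250_of_243` with their inputs (2.43)₁, weighted range, G′Δ′_a = I, local-inverse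
  property DISCHARGED.
§2 `card_filter_bdist_eq_one_le` (every site of the box has ≤ 2d sites at ℓ¹ distance 1, uniformly in the volume) and
  **`prop22_entry1_boxLaplacian`**: for Δ′_a = a + (−Δ_G), −Δ_G the Laplacian of ANY graph G on the box whose edges join
  ℓ¹-nearest neighbours (symmetric; a-coercive by `SimpleGraph.posSemidef_lapMatrix`; nearest-neighbour; κ₀ = 2d), a > 0,
  `2d(e^{δ₀} − 1) < a`, `0 < α ≤ 1`, `M > 2^d(3π/2)A·2de^{δ₀}K(αδ₀)` (A = (a − 2d(e^{δ₀} − 1))⁻¹): **`|(−Δ_G + a)⁻¹(x,y)| ≤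
  2^dAK(αδ₀)(1 − 2^d(3π/2)A·2de^{δ₀}M⁻¹K(αδ₀))⁻¹e^{−(1−α)δ₀|x−y|₁}`**, uniformly in the volume; **`prop22_entry1_neumannLaplacian`**:
  the fully explicit instance G = the nearest-neighbour graph `|x − y|₁ = 1` of the box (−Δ_G = the Neumann Laplacian
  −Δ_𝔅), i.e. (2.67)₁ for Δ′_a = −Δ_𝔅 + a with no hypothesis but a > 0 and the displayed sizes of δ₀, α, M.
HONEST SCOPE.  As in the companion: one scale, blocks = sites, box (not torus), Dirichlet local inverses, (2.43)₁ by finite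
Combes–Thomas; the conclusion of §2 is also a one-line consequence of Combes–Thomas for −Δ_G + a itself — what is certified
is the printed random-walk route (2.36)–(2.38), (2.43), (2.44), (2.50), (2.64)–(2.66) end-to-end on the model for the
printed operator.  Not treated: a = a_j level-dependent weights / Q′ ≠ I (several scales), derivative and Hölder entries.
-/

namespace Literature.MathematicalPhysics.QuantumFieldTheory.Balaban1983to89.B6Prop22BoxLaplacian

open Finset Matrix
open B6CoverBox (hprof bdist Kbox cubeInd bdist_self bdist_comm bdist_triangle bdist_nonneg hprof_nonneg hprof_le_one
  cubeInd_zero_or_one cubeInd_mul_hprof)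
open QGQInverse (Coercive inverse_decay isUnit_of_coercive mulVec_single_one_apply)
open B6Ineq243BoxProof (localInverse_decay localInverse_identity toLin_diagonal_apply toLin_single_apply toLin_inv_mul
  toLin_localInverse_identity toLin_weightedRange toLin_localInverse_decay prop22_entry1_box)

variable {d S n m : ℕ}

/-! ## §1. (2.44) and (2.50) on the one-scale box for an arbitrary symmetric coercive nearest-neighbour Δ′_a — hypothesis-free -/


/-- **(2.44) ON THE ONE-SCALE BOX, UNCONDITIONALLY.**  p. 230: *"This inequality [(2.43)] and (2.40) imply
|(K(h_□)G′(□)h_□λ)(x)| ≤ O(M⁻¹)e^{−δ₀|x−y|}|λ| (2.44)"*.  For every symmetric, coercive (`⟨v, Δ′_av⟩ ≥ γ‖v‖²`),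
nearest-neighbour `Δ′_a` with off-diagonal absolute row sums `≤ κ₀`, the cut-offs `h_k` of (2.36) (`B6CoverBox.hprof`,
Lipschitz constant (3π/2)/M) and the Dirichlet local inverses `G′(□_k) = □_kP⁻¹□_k` of §2 (P the padded compression of
□_k, `hP`), in matrix form: **`|((h_kΔ′_a − Δ′_ah_k)·G′(□_k)·h_k)(x,y)| ≤ (3π/2)·A·κ₀e^{δ₀}·M⁻¹·e^{−δ₀|x−y|₁}`**,
A = (γ − κ₀(e^{δ₀} − 1))⁻¹, for every `δ₀ ≥ 0` with `κ₀(e^{δ₀} − 1) < γ` — gen 2's `B6Ineq244BoxProof.box_kernel244_of_243`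
with its inputs `hD` ((2.40): weighted range κ₀e^{δ₀}) and `h243` ((2.43)₁, `localInverse_decay`) DISCHARGED.
[cite: Balaban1984PropagatorsII, (2.44) p.230] -/
theorem box_kernel244_dirichlet (hm : 0 < m) {γ δ₀ κ₀ : ℝ} (hδ₀ : 0 ≤ δ₀)
    (Dm : Matrix (Fin d → Fin (n * m + 1)) (Fin d → Fin (n * m + 1)) ℝ) (hsymm : Dm.IsSymm) (hcoer : Coercive Dm γ)
    (hnn : ∀ x y, 1 < bdist x y → Dm x y = 0)
    (hrow : ∀ x, ∑ y ∈ Finset.univ.filter (fun y => y ≠ x), |Dm x y| ≤ κ₀)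
    (hρ : κ₀ * (Real.exp δ₀ - 1) < γ) (k : Fin d → Fin (n + 1))
    (P : Matrix (Fin d → Fin (n * m + 1)) (Fin d → Fin (n * m + 1)) ℝ)
    (hP : ∀ x y, P x y = cubeInd m k x * Dm x y * cubeInd m k y +
      γ * (1 - cubeInd m k x) * (if x = y then 1 else 0)) (x y : Fin d → Fin (n * m + 1)) :
    |((diagonal (hprof m k : (Fin d → Fin (n * m + 1)) → ℝ) * Dm - Dm * diagonal (hprof m k : (Fin d → Fin (n * m + 1)) → ℝ)) *
        (diagonal (cubeInd m k : (Fin d → Fin (n * m + 1)) → ℝ) * P⁻¹ * diagonal (cubeInd m k : (Fin d → Fin (n * m + 1)) → ℝ)) *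
        diagonal (hprof m k : (Fin d → Fin (n * m + 1)) → ℝ)) x y| ≤
      3 * Real.pi / 2 * (γ - κ₀ * (Real.exp δ₀ - 1))⁻¹ * (κ₀ * Real.exp δ₀) / m *
        Real.exp (-(δ₀ * bdist x y)) := by
  classical
  have hκ₀ : 0 ≤ κ₀ := le_trans (Finset.sum_nonneg fun y _ => abs_nonneg _) (hrow x)
  have hApos : 0 < (γ - κ₀ * (Real.exp δ₀ - 1))⁻¹ := by
    refine inv_pos.mpr ?_
    have : 0 ≤ κ₀ * (Real.exp δ₀ - 1) := mul_nonneg hκ₀ (by linarith [Real.add_one_le_exp δ₀])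
    linarith
  -- the whole family of padded compressions (the chain's `h243` quantifies over all cubes)
  set Pf : (Fin d → Fin (n + 1)) → Matrix (Fin d → Fin (n * m + 1)) (Fin d → Fin (n * m + 1)) ℝ := fun k' =>
    Matrix.of fun x y => cubeInd m k' x * Dm x y * cubeInd m k' y + γ * (1 - cubeInd m k' x) * (if x = y then 1 else 0)
    with hPfdef
  have hPf : ∀ k' x y, Pf k' x y =
      cubeInd m k' x * Dm x y * cubeInd m k' y + γ * (1 - cubeInd m k' x) * (if x = y then 1 else 0) :=
    fun k' x y => rfl
  have hPk : Pf k = P := by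
    ext x' y'
    rw [hPf, hP]
  set D : Module.End ℝ ((Fin d → Fin (n * m + 1)) → ℝ) := Matrix.toLin' Dm with hDdef
  set h : (Fin d → Fin (n + 1)) → Module.End ℝ ((Fin d → Fin (n * m + 1)) → ℝ) := fun k' =>
    Matrix.toLin' (diagonal (hprof m k')) with hhdef
  set gl : (Fin d → Fin (n + 1)) → Module.End ℝ ((Fin d → Fin (n * m + 1)) → ℝ) := fun k' =>
    Matrix.toLin' (diagonal (cubeInd m k') * (Pf k')⁻¹ * diagonal (cubeInd m k')) with hgldef
  have key := B6Ineq244BoxProof.box_kernel244_of_243 hm hδ₀ hApos.le D h gl (fun k' μ z => toLin_diagonal_apply _ μ z)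
    (toLin_weightedRange hδ₀ hnn hrow) (fun k' z' z => toLin_localInverse_decay hsymm hcoer hδ₀ hρ hnn hrow (hPf k') z' z) k y x
  have hb : B6Eq250.bTerm D h gl k =
      Matrix.toLin' ((diagonal (hprof m k) * Dm - Dm * diagonal (hprof m k)) *
        (diagonal (cubeInd m k) * P⁻¹ * diagonal (cubeInd m k)) * diagonal (hprof m k)) := by
    rw [B6Eq250.bTerm_apply, B6Eq250.kOp_def, hhdef, hDdef, hgldef]
    dsimp only
    rw [hPk]
    simp only [Module.End.mul_eq_comp, Matrix.toLin'_mul, map_sub, LinearMap.sub_comp]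
  rw [hb, toLin_single_apply] at key
  simpa only [mul_assoc, mul_comm, mul_left_comm] using key

/-- **(2.49) ⇒ (2.50) ON THE ONE-SCALE BOX, UNCONDITIONALLY: the random-walk expansion `G′ = Σ_n G′₀Rⁿ` converges to
`Δ′_a⁻¹` in the operator norm of L^∞ of the box.**  p. 232: *"From (2.38) we get G′ = G′₀(I − R)⁻¹ = Σ_{n=0}^∞ G′₀Rⁿ
(2.50)"*, under (2.49) `|(Rλ)(x)| ≤ O(M⁻¹)|λ|`.  For every symmetric, coercive (`⟨v, Δ′_av⟩ ≥ γ‖v‖²`, γ > 0),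
nearest-neighbour `Δ′_a` with off-diagonal absolute row sums `≤ κ₀`, the cut-offs `h_k` of (2.36) and the Dirichlet local
inverses `G′(□_k)` of §2 (all as continuous linear maps of L^∞ of the box), every `δ₀ > 0` with `κ₀(e^{δ₀} − 1) < γ` and
**`M > 2^dK(δ₀)·(3π/2)·A·κ₀e^{δ₀}`** (A = (γ − κ₀(e^{δ₀} − 1))⁻¹): `HasSum (N ↦ G′₀R^N) Δ′_a⁻¹` — gen 1/2's
`B6Ineq244BoxProof.box_neumann250_of_243` with its inputs `hGD`, `hloc`, `hD`, `h243` DISCHARGED.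
[cite: Balaban1984PropagatorsII, (2.49)–(2.50) p.232] -/
theorem box_neumann250_dirichlet (hm : 0 < m) {γ δ₀ κ₀ : ℝ} (hγ : 0 < γ) (hδ₀ : 0 < δ₀)
    (Dm : Matrix (Fin d → Fin (n * m + 1)) (Fin d → Fin (n * m + 1)) ℝ) (hsymm : Dm.IsSymm) (hcoer : Coercive Dm γ)
    (hnn : ∀ x y, 1 < bdist x y → Dm x y = 0)
    (hrow : ∀ x, ∑ y ∈ Finset.univ.filter (fun y => y ≠ x), |Dm x y| ≤ κ₀)
    (hρ : κ₀ * (Real.exp δ₀ - 1) < γ)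
    (hM : (2 : ℝ) ^ d * Kbox d δ₀ * (3 * Real.pi / 2 * (γ - κ₀ * (Real.exp δ₀ - 1))⁻¹ * (κ₀ * Real.exp δ₀)) < m) :
    HasSum
      (fun N : ℕ =>
        B6Eq250.gZero
            (fun k : Fin d → Fin (n + 1) => LinearMap.toContinuousLinearMap
              (Matrix.toLin' (diagonal (hprof m k : (Fin d → Fin (n * m + 1)) → ℝ))))
            (fun k : Fin d → Fin (n + 1) => LinearMap.toContinuousLinearMap
              (Matrix.toLin' (diagonal (cubeInd m k : (Fin d → Fin (n * m + 1)) → ℝ) *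
                (Matrix.of fun x y : Fin d → Fin (n * m + 1) =>
                  cubeInd m k x * Dm x y * cubeInd m k y + γ * (1 - cubeInd m k x) * (if x = y then (1 : ℝ) else 0))⁻¹ *
                diagonal (cubeInd m k : (Fin d → Fin (n * m + 1)) → ℝ)))) *
          B6Eq250.rOp (LinearMap.toContinuousLinearMap (Matrix.toLin' Dm))
            (fun k : Fin d → Fin (n + 1) => LinearMap.toContinuousLinearMap
              (Matrix.toLin' (diagonal (hprof m k : (Fin d → Fin (n * m + 1)) → ℝ))))
            (fun k : Fin d → Fin (n + 1) => LinearMap.toContinuousLinearMap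
              (Matrix.toLin' (diagonal (cubeInd m k : (Fin d → Fin (n * m + 1)) → ℝ) *
                (Matrix.of fun x y : Fin d → Fin (n * m + 1) =>
                  cubeInd m k x * Dm x y * cubeInd m k y + γ * (1 - cubeInd m k x) * (if x = y then (1 : ℝ) else 0))⁻¹ *
                diagonal (cubeInd m k : (Fin d → Fin (n * m + 1)) → ℝ)))) ^ N)
      (LinearMap.toContinuousLinearMap (Matrix.toLin' Dm⁻¹)) := by
  classical
  obtain ⟨x0⟩ : Nonempty (Fin d → Fin (n * m + 1)) := ⟨fun _ => 0⟩
  have hκ₀ : 0 ≤ κ₀ := le_trans (Finset.sum_nonneg fun y _ => abs_nonneg _) (hrow x0)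
  have hApos : 0 < (γ - κ₀ * (Real.exp δ₀ - 1))⁻¹ := by
    refine inv_pos.mpr ?_
    have : 0 ≤ κ₀ * (Real.exp δ₀ - 1) := mul_nonneg hκ₀ (by linarith [Real.add_one_le_exp δ₀])
    linarith
  set P : (Fin d → Fin (n + 1)) → Matrix (Fin d → Fin (n * m + 1)) (Fin d → Fin (n * m + 1)) ℝ := fun k =>
    Matrix.of fun x y => cubeInd m k x * Dm x y * cubeInd m k y + γ * (1 - cubeInd m k x) * (if x = y then 1 else 0)
    with hPdef
  have hP : ∀ k x y, P k x y =
      cubeInd m k x * Dm x y * cubeInd m k y + γ * (1 - cubeInd m k x) * (if x = y then 1 else 0) :=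
    fun k x y => rfl
  refine B6Ineq244BoxProof.box_neumann250_of_243 hm hδ₀ hApos.le (by positivity) _ _ _ _ ?_ ?_ ?_ ?_ ?_ hM
  · intro k μ z
    rw [LinearMap.coe_toContinuousLinearMap', toLin_diagonal_apply]
  · ext1 v
    rw [mul_apply_eq_comp, one_apply_eq_self, LinearMap.coe_toContinuousLinearMap',
      LinearMap.coe_toContinuousLinearMap', ← Module.End.mul_apply, toLin_inv_mul hγ hcoer, Module.End.one_apply]
  · intro k
    ext1 v
    have e := congrArg (fun T : Module.End ℝ ((Fin d → Fin (n * m + 1)) → ℝ) => T v) (toLin_localInverse_identity hm hγ hcoer (hP k))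
    simp only [Module.End.mul_apply] at e
    simpa only [mul_apply_eq_comp, LinearMap.coe_toContinuousLinearMap'] using e
  · intro z
    simpa only [LinearMap.coe_toContinuousLinearMap'] using toLin_weightedRange hδ₀.le hnn hrow z
  · intro k z' z
    simpa only [LinearMap.coe_toContinuousLinearMap'] using toLin_localInverse_decay hsymm hcoer hδ₀.le hρ hnn hrow (hP k) z' z


/-! ## §2. The printed operator: `Δ′_a = −Δ + a` on the one-scale box (Q′₀ = I in (2.13)), −Δ the Laplacian of any
nearest-neighbour graph on the box (Mathlib's `SimpleGraph.lapMatrix`; the full nearest-neighbour graph gives the Neumann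
Laplacian of the box) — every hypothesis of §3 discharged -/

section Laplacian

/-- Distinct natural numbers are at real distance ≥ 1. [folklore] -/
private theorem one_le_abs_natCast_sub {a b : ℕ} (h : a ≠ b) : (1 : ℝ) ≤ |(a : ℝ) - (b : ℝ)| := by
  rcases lt_or_gt_of_ne h with hab | hab
  · have h1 : (a : ℝ) + 1 ≤ b := by exact_mod_cast hab
    rw [abs_sub_comm, abs_of_nonneg (by linarith)]
    linarith
  · have h1 : (b : ℝ) + 1 ≤ a := by exact_mod_cast hab
    rw [abs_of_nonneg (by linarith)]
    linarith

/-- **At most 2d nearest neighbours**: on the box {0,…,S−1}^d every site has at most `2d` sites at ℓ¹ distance 1 (a site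
at distance 1 differs from x in exactly one coordinate, by ±1) — the star *"st(x)"* of (2.40) has at most 2d bonds, whence
the off-diagonal row sum ≤ 2d of the unit Laplacian, uniformly in the volume. [cite: Balaban1984PropagatorsII, (2.40) p.230] -/
theorem card_filter_bdist_eq_one_le (x : Fin d → Fin S) :
    (Finset.univ.filter fun y : Fin d → Fin S => bdist x y = 1).card ≤ 2 * d := by
  classical
  set Nb : Finset (Fin d → Fin S) := Finset.univ.filter fun y : Fin d → Fin S => bdist x y = 1 with hNb
  set T : Fin d → Finset (Fin d → Fin S) := fun μ => Nb.filter fun y => y μ ≠ x μ with hT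
  have hcover : Nb ⊆ Finset.univ.biUnion T := by
    intro y hy
    have hy1 : bdist x y = 1 := (Finset.mem_filter.mp hy).2
    have hne : y ≠ x := by
      rintro rfl
      rw [bdist_self] at hy1
      norm_num at hy1
    obtain ⟨μ, hμ⟩ := Function.ne_iff.mp hne
    exact Finset.mem_biUnion.mpr ⟨μ, Finset.mem_univ _, Finset.mem_filter.mpr ⟨hy, hμ⟩⟩
  have hstruct : ∀ μ, ∀ y ∈ T μ,
      (∀ ν, ν ≠ μ → y ν = x ν) ∧ ((y μ : ℕ) = (x μ : ℕ) + 1 ∨ (y μ : ℕ) + 1 = (x μ : ℕ)) := by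
    intro μ y hy
    obtain ⟨hyNb, hyμ⟩ := Finset.mem_filter.mp hy
    have hy1 : ∑ ν, |B6CoverBox.crd x ν - B6CoverBox.crd y ν| = 1 := (Finset.mem_filter.mp hyNb).2
    have hμ1 : (1 : ℝ) ≤ |B6CoverBox.crd x μ - B6CoverBox.crd y μ| :=
      one_le_abs_natCast_sub fun h => hyμ (Fin.ext h).symm
    have hsplit := Finset.add_sum_erase Finset.univ (fun ν => |B6CoverBox.crd x ν - B6CoverBox.crd y ν|)
      (Finset.mem_univ μ)
    have hrest_nonneg : 0 ≤ ∑ ν ∈ Finset.univ.erase μ, |B6CoverBox.crd x ν - B6CoverBox.crd y ν| :=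
      Finset.sum_nonneg fun _ _ => abs_nonneg _
    have hrest0 : ∑ ν ∈ Finset.univ.erase μ, |B6CoverBox.crd x ν - B6CoverBox.crd y ν| = 0 := by linarith
    have hμeq : |B6CoverBox.crd x μ - B6CoverBox.crd y μ| = 1 := by linarith
    refine ⟨fun ν hν => ?_, ?_⟩
    · have h0 := (Finset.sum_eq_zero_iff_of_nonneg fun _ _ => abs_nonneg _).mp hrest0 ν
        (Finset.mem_erase.mpr ⟨hν, Finset.mem_univ ν⟩)
      have h1 : B6CoverBox.crd x ν = B6CoverBox.crd y ν := by
        have := abs_eq_zero.mp h0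
        linarith
      unfold B6CoverBox.crd at h1
      exact Fin.ext (by exact_mod_cast h1.symm)
    · unfold B6CoverBox.crd at hμeq
      rcases (abs_eq zero_le_one).mp hμeq with h | h
      · right
        exact_mod_cast (by linarith : ((y μ : ℕ) : ℝ) + 1 = ((x μ : ℕ) : ℝ))
      · left
        exact_mod_cast (by linarith : ((y μ : ℕ) : ℝ) = ((x μ : ℕ) : ℝ) + 1)
  have hT2 : ∀ μ, (T μ).card ≤ 2 := by
    intro μ
    calc (T μ).card ≤ ({(x μ : ℕ) + 1, (x μ : ℕ) - 1} : Finset ℕ).card :=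
        Finset.card_le_card_of_injOn (fun y : Fin d → Fin S => (y μ : ℕ))
          (fun y hy => by
            rcases (hstruct μ y (Finset.mem_coe.mp hy)).2 with h | h
            · simp [h]
            · have h' : (y μ : ℕ) = (x μ : ℕ) - 1 := by omega
              simp [h'])
          (fun y hy y' hy' hyy' => by
            funext ν
            by_cases hν : ν = μ
            · subst hν
              exact Fin.ext hyy'
            · rw [(hstruct μ y (Finset.mem_coe.mp hy)).1 ν hν, (hstruct μ y' (Finset.mem_coe.mp hy')).1 ν hν])
      _ ≤ 2 := Finset.card_le_two
  calc Nb.card ≤ (Finset.univ.biUnion T).card := Finset.card_le_card hcover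
    _ ≤ ∑ μ, (T μ).card := Finset.card_biUnion_le
    _ ≤ ∑ _μ : Fin d, 2 := Finset.sum_le_sum fun μ _ => hT2 μ
    _ = 2 * d := by simp [mul_comm]

variable (G : SimpleGraph (Fin d → Fin (n * m + 1))) [DecidableRel G.Adj]

/-- Entries of `Δ′_a = a + (−Δ_G)`: diagonal `a + deg`, off-diagonal `−[x ∼ y]`. [folklore] -/
private theorem lapA_apply (a : ℝ) (x y : Fin d → Fin (n * m + 1)) :
    (a • (1 : Matrix (Fin d → Fin (n * m + 1)) (Fin d → Fin (n * m + 1)) ℝ) + G.lapMatrix ℝ) x y =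
      (if x = y then a + (G.degree x : ℝ) else 0) - (if G.Adj x y then 1 else 0) := by
  rw [Matrix.add_apply, Matrix.smul_apply, Matrix.one_apply, SimpleGraph.lapMatrix, Matrix.sub_apply,
    SimpleGraph.degMatrix, Matrix.diagonal_apply, SimpleGraph.adjMatrix_apply, smul_eq_mul]
  by_cases hxy : x = y
  · subst hxy
    simp
  · simp [hxy]

/-- **PROPOSITION 2.2, FIRST ENTRY OF (2.67), FOR THE PRINTED OPERATOR `Δ′_a = −Δ + a` ON THE ONE-SCALE BOX — NO
HYPOTHESIS LEFT BUT SIZES.**  (2.13) p. 225: *"Δ′_a = Δ + Q′*aQ′ … (Q′₀λ)(x) = λ(x) on Λ₀"*, so on one scale with blocks =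
sites Δ′_a is the unit-lattice operator −Δ + a (a > 0); here −Δ = the graph Laplacian (`SimpleGraph.lapMatrix`, Mathlib) of
ANY graph `G` on the box whose edges join ℓ¹-nearest neighbours (`hG`; the full nearest-neighbour graph of the box is the
Neumann Laplacian, sub-graphs are admitted).  Then Δ′_a is symmetric, `⟨v, Δ′_av⟩ ≥ a‖v‖²` (`SimpleGraph.posSemidef_lapMatrix`),
nearest-neighbour with off-diagonal absolute row sums `≤ 2d` (`card_filter_bdist_eq_one_le`), and `prop22_entry1_box`
gives, for every `δ₀ > 0` with `2d(e^{δ₀} − 1) < a`, every `0 < α ≤ 1` and **`M > 2^d·(3π/2)·A·2de^{δ₀}·K(αδ₀)`**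
(A = (a − 2d(e^{δ₀} − 1))⁻¹): **`|(−Δ + a)⁻¹(x,y)| ≤ 2^dA·K(αδ₀)·(1 − 2^d(3π/2)A·2de^{δ₀}M⁻¹K(αδ₀))⁻¹·e^{−(1−α)δ₀|x−y|₁}`**,
uniformly in the volume — (2.67)₁ by the printed random-walk route, every input discharged.
[cite: Balaban1984PropagatorsII, Prop. 2.2 (2.67) p.234; (2.13) p.225] -/
theorem prop22_entry1_boxLaplacian (hm : 0 < m) {a δ₀ α : ℝ} (ha : 0 < a) (hδ₀ : 0 < δ₀) (hα : 0 < α)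
    (hα1 : α ≤ 1) (hG : ∀ x y, G.Adj x y → bdist x y = 1) (hρ : 2 * d * (Real.exp δ₀ - 1) < a)
    (hM : (2 : ℝ) ^ d * (3 * Real.pi / 2 * (a - 2 * d * (Real.exp δ₀ - 1))⁻¹ * (2 * d * Real.exp δ₀)) *
      Kbox d (α * δ₀) < m) (x y : Fin d → Fin (n * m + 1)) :
    |(a • (1 : Matrix (Fin d → Fin (n * m + 1)) (Fin d → Fin (n * m + 1)) ℝ) + G.lapMatrix ℝ)⁻¹ x y| ≤
      (2 : ℝ) ^ d * (a - 2 * d * (Real.exp δ₀ - 1))⁻¹ * Kbox d (α * δ₀) *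
        (1 - (2 : ℝ) ^ d * (3 * Real.pi / 2 * (a - 2 * d * (Real.exp δ₀ - 1))⁻¹ * (2 * d * Real.exp δ₀) / m) *
          Kbox d (α * δ₀))⁻¹ * Real.exp (-((1 - α) * δ₀ * bdist x y)) := by
  classical
  set Dm := a • (1 : Matrix (Fin d → Fin (n * m + 1)) (Fin d → Fin (n * m + 1)) ℝ) + G.lapMatrix ℝ with hDm
  -- symmetric
  have hsymm : Dm.IsSymm := ((Matrix.isSymm_one).smul a).add (G.isSymm_lapMatrix ℝ)
  -- coercive with the mass a: ⟨v, (a − Δ)v⟩ = a‖v‖² + ⟨v, −Δv⟩ ≥ a‖v‖²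
  have hcoer : Coercive Dm a := by
    intro v
    have hL : 0 ≤ v ⬝ᵥ (G.lapMatrix ℝ *ᵥ v) := by
      have := (G.posSemidef_lapMatrix ℝ).dotProduct_mulVec_nonneg v
      simpa using this
    rw [hDm, Matrix.add_mulVec, Matrix.smul_mulVec, Matrix.one_mulVec, dotProduct_add, dotProduct_smul,
      smul_eq_mul]
    linarith
  -- nearest-neighbour
  have hnn : ∀ x y, 1 < bdist x y → Dm x y = 0 := by
    intro x y hxy
    have hne : x ≠ y := by
      rintro rfl
      rw [bdist_self] at hxy
      linarith
    have hnadj : ¬ G.Adj x y := fun h => by rw [hG x y h] at hxy; exact lt_irrefl _ hxy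
    rw [hDm, lapA_apply, if_neg hne, if_neg hnadj, sub_zero]
  -- off-diagonal absolute row sums ≤ 2d
  have hrow : ∀ x, ∑ y ∈ Finset.univ.filter (fun y => y ≠ x), |Dm x y| ≤ 2 * d := by
    intro x
    have hterm : ∀ y ∈ Finset.univ.filter (fun y => y ≠ x),
        |Dm x y| = if bdist x y = 1 then (if G.Adj x y then 1 else 0) else 0 := by
      intro y hy
      have hne : x ≠ y := Ne.symm (Finset.mem_filter.mp hy).2
      rw [hDm, lapA_apply, if_neg hne, zero_sub, abs_neg]
      by_cases hadj : G.Adj x y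
      · rw [if_pos hadj, if_pos (hG x y hadj), abs_one]
      · rw [if_neg hadj, abs_zero]
        split_ifs <;> rfl
    rw [Finset.sum_congr rfl hterm, ← Finset.sum_filter]
    calc ∑ y ∈ (Finset.univ.filter (fun y => y ≠ x)).filter (fun y => bdist x y = 1),
          (if G.Adj x y then (1 : ℝ) else 0)
        ≤ ∑ y ∈ (Finset.univ.filter (fun y => y ≠ x)).filter (fun y => bdist x y = 1), (1 : ℝ) :=
          Finset.sum_le_sum fun y _ => by split_ifs <;> norm_num
      _ = (((Finset.univ.filter (fun y => y ≠ x)).filter (fun y => bdist x y = 1)).card : ℝ) := by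
          rw [Finset.sum_const, nsmul_eq_mul, mul_one]
      _ ≤ ((Finset.univ.filter fun y : Fin d → Fin (n * m + 1) => bdist x y = 1).card : ℝ) := by
          exact_mod_cast Finset.card_le_card (fun y hy => by
            rw [Finset.mem_filter] at hy ⊢
            exact ⟨Finset.mem_univ _, hy.2⟩)
      _ ≤ 2 * d := by exact_mod_cast card_filter_bdist_eq_one_le x
  exact prop22_entry1_box hm ha hδ₀ hα hα1 Dm hsymm hcoer hnn hrow hρ hM x y

open Classical in
/-- **The fully explicit instance**: the Neumann Laplacian −Δ_𝔅 of the box 𝔅 = {0,…,nM}^d (the graph Laplacian of the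
nearest-neighbour relation `|x − y|₁ = 1`), Δ′_a = −Δ_𝔅 + a: (2.67)₁ `|Δ′_a⁻¹(x,y)| ≤ O(1)e^{−(1−α)δ₀|x−y|₁}` with the
constants of `prop22_entry1_boxLaplacian`, for a > 0, 0 < δ₀ with 2d(e^{δ₀} − 1) < a, 0 < α ≤ 1 and M large as displayed —
no further hypothesis. [cite: Balaban1984PropagatorsII, Prop. 2.2 (2.67) p.234; (2.13) p.225] -/
theorem prop22_entry1_neumannLaplacian (hm : 0 < m) {a δ₀ α : ℝ} (ha : 0 < a) (hδ₀ : 0 < δ₀) (hα : 0 < α)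
    (hα1 : α ≤ 1) (hρ : 2 * d * (Real.exp δ₀ - 1) < a)
    (hM : (2 : ℝ) ^ d * (3 * Real.pi / 2 * (a - 2 * d * (Real.exp δ₀ - 1))⁻¹ * (2 * d * Real.exp δ₀)) *
      Kbox d (α * δ₀) < m) (x y : Fin d → Fin (n * m + 1)) :
    |(a • (1 : Matrix (Fin d → Fin (n * m + 1)) (Fin d → Fin (n * m + 1)) ℝ) +
        (SimpleGraph.fromRel fun x y : Fin d → Fin (n * m + 1) => bdist x y = 1).lapMatrix ℝ)⁻¹ x y| ≤
      (2 : ℝ) ^ d * (a - 2 * d * (Real.exp δ₀ - 1))⁻¹ * Kbox d (α * δ₀) *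
        (1 - (2 : ℝ) ^ d * (3 * Real.pi / 2 * (a - 2 * d * (Real.exp δ₀ - 1))⁻¹ * (2 * d * Real.exp δ₀) / m) *
          Kbox d (α * δ₀))⁻¹ * Real.exp (-((1 - α) * δ₀ * bdist x y)) :=
  prop22_entry1_boxLaplacian (SimpleGraph.fromRel fun x y : Fin d → Fin (n * m + 1) => bdist x y = 1) hm ha hδ₀ hα hα1
    (fun x y hxy => by
      rcases (SimpleGraph.fromRel_adj _ x y).mp hxy with ⟨_, h | h⟩
      · exact h
      · rw [bdist_comm]; exact h)
    hρ hM x y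

end Laplacian

end Literature.MathematicalPhysics.QuantumFieldTheory.Balaban1983to89.B6Prop22BoxLaplacian
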